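import Summits.CriticalPhenomena.PercolationContinuityZ3.Theorems.PercNearOneGluingNoHeavyRsw3SetToSetHardCrossing
import Summits.CriticalPhenomena.PercolationContinuityZ3.Theorems.PercAnnulusCrossingIICCorollaries
import Summits.CriticalPhenomena.PercolationContinuityZ3.Theorems.PercAnnulusCrossingSetToSetCondConnection
import Summits.CriticalPhenomena.PercolationContinuityZ3.Theorems.PercNearOneGluingNoHeavyRsw3HardCrossingRate
import Summits.CriticalPhenomena.PercolationContinuityZ3.Theorems.PercAnnulusCrossingIICOfUniformCondConn
import Summits.CriticalPhenomena.PercolationContinuityZ3.Theorems.PercAnnulusCrossingMetricToBoxRendering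
import HarnessLib

/-!
# RSW3 lane (P2, gen 16): corollaries of "(A2)□ at `p_c(ℤ³)` ⇒ the lower half of 3-D RSW" — the tube correlation length is linear,
# the conditional-connection form, and the joint statement with Kesten's IIC

builds on p205010 (kernel theorem, internal audit signed; external expert review pending) — used only through the imported IIC corollary
(`kestenIICExists_of_setToSetQuasiMult` needs `θ(p_c) = 0`); the RSW half does not use it.

Cell `prim-rsw3`, prover seat `prim-rsw3-p2` (gen 16), memo `run/shared/lean/prim/rsw3/P2-RSWLITE.md` §23.
Support file (`--supports stmt-CriticalPhenomena-4575`); no definitions, no named facts, no sorries.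

* `bddAbove_rate_of_setToSetQuasiMult` — under `Crossing.SetToSetQuasiMult` the critical hard-crossing rates are `O(1/N)`: for every width
  `N ≥ 1`, if `-log P_{p_c}(boxCross ![ℓ, N, N] 0)/ℓ → γ` then `N·γ ≤ M` (one `M`), i.e. the tube correlation length `ξ_{p_c}(N) = 1/μ_{p_c}(N)`
  of the lead's `…TubeCorrelationLength*` is `≥ N/M` — via p2 gen 7's dictionary `geometric_hardCrossingLowerBound_iff_bddAbove_rate`.
* `geometricHardCrossingLowerBound_of_condConn` — the CONDITIONAL-CONNECTION form (lead gen 3, V49, `setToSetQuasiMult_iff_condConn`): if at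
  `p_c(ℤ³)` two clusters of `Z` reaching the middle sphere `∂ⁱⁿΛ(2m)` from `X ⊆ Λ(m)` and from `Y` outside `Λ(4m)` are joined inside `Z` with
  conditional probability `≥ c > 0`, uniformly, then `GeometricHardCrossingLowerBound`.
* `kestenIICExists_and_geometricHardCrossingLowerBound_of_setToSetQuasiMult` — the single LANE-4 input (A2)□ at `p_c(ℤ³)` now carries BOTH
  Kesten's incipient infinite cluster (p1, Basu–Sapozhnikov Thm 1.1 in boxes) AND the lower half of 3-D RSW with geometric constants.
* `geometricHardCrossingLowerBound_of_setToSetQM'_aspect`, `geometricHardCrossingLowerBound_of_condAnnulusUniq_aspect` — the crossed-spheres form (A2′)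
  and CONDITIONAL ANNULUS UNIQUENESS CU_l at any fixed aspect `l ≥ 2` (p1's reductions p219928) also give `GeometricHardCrossingLowerBound`.
* `geometricHardCrossingLowerBound_of_basuSapozhnikovQM` — THE PRINTED HYPOTHESIS VERBATIM: Basu–Sapozhnikov's (A2) with graph-metric balls
  (`Literature…BasuSapozhnikovQM (zdGraph 3) 0 p_c ϰ`) ⇒ `GeometricHardCrossingLowerBound`, through the lead's rendering theorem
  `setToSetQuasiMultAspectAt_of_basuSapozhnikovQM` (box form at aspect `(12, 144)`).
* `geometricHardCrossingLowerBound_of_uniform_condConn` — THE BRIDGE FORM (lead gen 12, V141, `exists_setToSetQuasiMultAt_criticalProbI_of_uniform_condConn`):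
  a conditional-connection floor `c₀ > 0` holding UNIFORMLY for `p ∈ (p_c, q)` beyond a fixed scale `M₀` (where (A2)□ is a theorem at each fixed
  `p`, lead V133/V137, but with `p`-dependent constants) already gives `GeometricHardCrossingLowerBound` at `p_c(ℤ³)`.

References: D. Basu, A. Sapozhnikov, Electron. Commun. Probab. 22 (2017) no. 26, §1 (A2), Thm. 1.1 [BasuSapozhnikov2017ECP]; H. Kesten,
*Percolation Theory for Mathematicians* (1982), §3.3 Comment (v) [Kesten1982]; H. Kesten, Probab. Theory Related Fields 73 (1986) 369–394,
Thm. 3 [Kesten1986]. [folklore]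
-/

noncomputable section

namespace Summit.CriticalPhenomena.PercolationContinuityZ3.Theorems

namespace Rsw3

open MeasureTheory Filter Topology Literature.Probability.LatticeModels Literature.Probability.Percolation
open SurfaceTension Crossing SimpleGraph

/-- **(A2)□ at `p_c(ℤ³)` ⇒ the critical hard-crossing rates are `O(1/N)`** (the tube correlation length is at least linear in the width):
`SetToSetQuasiMult → ∃ M, ∀ N ≥ 1, ∀ γ, (-log P_{p_c}(boxCross ![ℓ,N,N] 0)/ℓ → γ) → N·γ ≤ M`.
[cite: BasuSapozhnikov2017ECP, §1 assumption (A2)] [cite: Kesten1982, §3.3 Comment (v)] -/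
theorem bddAbove_rate_of_setToSetQuasiMult (h : SetToSetQuasiMult) :
    ∃ M : ℝ, ∀ N : ℕ, 1 ≤ N → ∀ γ : ℝ,
      Tendsto (fun ℓ : ℕ =>
        -Real.log ((bondPercolation (zdGraph 3) (criticalProbI 3)).real
          (boxCross (![(ℓ : ℤ), N, N] : Site 3) 0)) / ℓ) atTop (𝓝 γ) →
      (N : ℝ) * γ ≤ M := by
  obtain ⟨c, hc, hgeo⟩ := geometricHardCrossingLowerBound_of_setToSetQuasiMult h
  refine geometric_hardCrossingLowerBound_iff_bddAbove_rate.1 ⟨min c 1, lt_min hc one_pos, fun a N ha hN => ?_⟩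
  have h0 : 0 ≤ min c 1 := (lt_min hc one_pos).le
  calc (min c 1) ^ (a + 1) ≤ (min c 1) ^ a := pow_le_pow_of_le_one h0 (min_le_right _ _) (Nat.le_succ a)
    _ ≤ c ^ a := pow_le_pow_left₀ h0 (min_le_left _ _) a
    _ ≤ (bondPercolation (zdGraph 3) (criticalProbI 3)).real (boxCross (hardShape a N) 0) := hgeo a N ha hN

/-- **The conditional-connection form.**  If at `p_c(ℤ³)`, for some `c > 0` and all `m ≥ 1`, finite `Z ⊇ Λ(4m) ∖ Λ(m-1)`, `X ⊆ Z ∩ Λ(m)`,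
`Y ⊆ Z ∖ Λ(4m)`: `c · P[X ↔ ∂ⁱⁿΛ(2m) in Z and Y ↔ ∂ⁱⁿΛ(2m) in Z] ≤ P[X ↔ Y in Z]` (two sphere-reaching clusters are one cluster with
conditional probability `≥ c`), then `GeometricHardCrossingLowerBound` (lead gen 3's `setToSetQuasiMult_iff_condConn` + this generation's
theorem). [cite: BasuSapozhnikov2017ECP, §1 assumption (A2) and the comments on p. 4] -/
theorem geometricHardCrossingLowerBound_of_condConn {c : ℝ} (hc : 0 < c)
    (h : ∀ m : ℕ, 1 ≤ m → ∀ Z : Finset (Site 3), box 3 (4 * m) \ box 3 (m - 1) ⊆ Z →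
        ∀ X : Finset (Site 3), X ⊆ Z ∩ box 3 m → ∀ Y : Finset (Site 3), Y ⊆ Z \ box 3 (4 * m) →
          c * (bondPercolation (zdGraph 3) (criticalProbI 3)).real
              ({ω : BondConfig (Site 3) | ∃ x ∈ X, ∃ s ∈ innerBoundary (zdGraph 3) (box 3 (2 * m)),
                  ω ∈ openConnIn (↑Z : Set (Site 3)) x s} ∩
                {ω | ∃ y ∈ Y, ∃ s ∈ innerBoundary (zdGraph 3) (box 3 (2 * m)),
                  ω ∈ openConnIn (↑Z : Set (Site 3)) y s}) ≤
            (bondPercolation (zdGraph 3) (criticalProbI 3)).real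
              {ω : BondConfig (Site 3) | ∃ x ∈ X, ∃ y ∈ Y, ω ∈ openConnIn (↑Z : Set (Site 3)) x y}) :
    GeometricHardCrossingLowerBound :=
  geometricHardCrossingLowerBound_of_setToSetQuasiMult (setToSetQuasiMult_iff_condConn.2 ⟨c, hc, h⟩)

/-- **(A2)□ at `p_c(ℤ³)` carries both LANE-4's target and (S1-lo)**: `SetToSetQuasiMult → KestenIICExists ∧ GeometricHardCrossingLowerBound`
(the IIC half is p1's box form of Basu–Sapozhnikov Thm 1.1 and uses `θ(p_c) = 0`; the RSW half is this generation's).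
[cite: BasuSapozhnikov2017ECP, Thm. 1.1] [cite: Kesten1986, Thm. 3] -/
theorem kestenIICExists_and_geometricHardCrossingLowerBound_of_setToSetQuasiMult (h : SetToSetQuasiMult) :
    KestenIICExists ∧ GeometricHardCrossingLowerBound :=
  ⟨kestenIICExists_of_setToSetQuasiMult h, geometricHardCrossingLowerBound_of_setToSetQuasiMult h⟩

/-- **The bridge form: a UNIFORM conditional-connection floor slightly above `p_c(ℤ³)` gives 3-D RSW's lower half at `p_c`.**  If for some
`q > p_c`, `c₀ > 0`, `M₀` and all `p ∈ (p_c, q)`, `m ≥ M₀`, finite `Z ⊇ Λ(4m) ∖ Λ(m-1)`, `X ⊆ Z ∩ Λ(m)`, `Y ⊆ Z ∖ Λ(4m)`: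
`c₀ · P_p[X ↔ ∂ⁱⁿΛ(2m), Y ↔ ∂ⁱⁿΛ(2m) in Z] ≤ P_p[X ↔ Y in Z]`, then `GeometricHardCrossingLowerBound` (at `p_c`).  The lead's closedness-in-`p` bridge
(`exists_setToSetQuasiMultAt_criticalProbI_of_uniform_condConn`, p270089) followed by this generation's theorem.
[cite: BasuSapozhnikov2017ECP, §1 assumption (A2)] [cite: Kesten1982, §3.3 Comment (v)] -/
theorem geometricHardCrossingLowerBound_of_uniform_condConn {q : unitInterval} (hq : criticalProbI 3 < q) {c₀ : ℝ} (hc₀ : 0 < c₀)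
    {M₀ : ℕ}
    (h : ∀ p : unitInterval, criticalProbI 3 < p → p < q → ∀ m : ℕ, M₀ ≤ m →
      ∀ Z : Finset (Site 3), box 3 (4 * m) \ box 3 (m - 1) ⊆ Z →
      ∀ X : Finset (Site 3), X ⊆ Z ∩ box 3 m → ∀ Y : Finset (Site 3), Y ⊆ Z \ box 3 (4 * m) →
        c₀ * (bondPercolation (zdGraph 3) p).real
            ({ω | ∃ x ∈ X, ∃ s ∈ innerBoundary (zdGraph 3) (box 3 (2 * m)), ω ∈ openConnIn (↑Z : Set (Site 3)) x s} ∩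
              {ω | ∃ y ∈ Y, ∃ s ∈ innerBoundary (zdGraph 3) (box 3 (2 * m)), ω ∈ openConnIn (↑Z : Set (Site 3)) y s}) ≤
          (bondPercolation (zdGraph 3) p).real {ω | ∃ x ∈ X, ∃ y ∈ Y, ω ∈ openConnIn (↑Z : Set (Site 3)) x y}) :
    GeometricHardCrossingLowerBound := by
  obtain ⟨ϰ, hϰ, hA2⟩ := exists_setToSetQuasiMultAt_criticalProbI_of_uniform_condConn (d := 3) (by norm_num) hq hc₀ h
  exact geometricHardCrossingLowerBound_of_setToSetQuasiMult ⟨ϰ, hϰ, hA2⟩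

/-- **(A2′) at aspect `l` ⇒ 3-D RSW's lower half** (`l ≥ 2`, `c > 0`): Basu–Sapozhnikov's crossed-spheres form (13)–(14) at `p_c(ℤ³)` and aspect `l`
gives (A2)□ at aspect `(l, l²)` (p1's `setToSetQM_fixedAspect_of_setToSetQM'`, constant `c²·6⁻¹·(4l²)⁻²`), hence `GeometricHardCrossingLowerBound`.
[cite: BasuSapozhnikov2017ECP, §3 eqs. (13)–(14)] -/
theorem geometricHardCrossingLowerBound_of_setToSetQM'_aspect {l : ℕ} (hl : 2 ≤ l) {c : ℝ} (hc : 0 < c)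
    (hA2' : ∀ a : ℕ, 1 ≤ a → ∀ Z : Finset (Site 3), box 3 (l * a) \ box 3 (a - 1) ⊆ Z →
      ∀ X : Finset (Site 3), X ⊆ Z ∩ box 3 a → ∀ Y : Finset (Site 3), Y ⊆ Z \ box 3 (l * a) →
        c * (bondPercolation (zdGraph 3) (criticalProbI 3)).real
              {ω | ∃ x ∈ X, ∃ s ∈ innerBoundary (zdGraph 3) (box 3 (l * a)), ω ∈ openConnIn (↑Z : Set (Site 3)) x s} *
            (bondPercolation (zdGraph 3) (criticalProbI 3)).real
              {ω | ∃ y ∈ Y, ∃ s ∈ innerBoundary (zdGraph 3) (box 3 a), ω ∈ openConnIn (↑Z : Set (Site 3)) y s} ≤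
          (bondPercolation (zdGraph 3) (criticalProbI 3)).real
            {ω | ∃ x ∈ X, ∃ y ∈ Y, ω ∈ openConnIn (↑Z : Set (Site 3)) x y}) :
    GeometricHardCrossingLowerBound := by
  have h := setToSetQM_fixedAspect_of_setToSetQM' (d := 3) (by norm_num) hl hc.le hA2'
  have hA2 : SetToSetQuasiMultAspectAt 3 (criticalProbI 3) l (l * l)
      (c ^ 2 * ((2 * ((3 : ℕ) : ℝ))⁻¹ * ((1 : ℝ) / (4 * ((l : ℝ) * l))) ^ (3 - 1))) := by
    intro m hm Z hZ X hX Y hY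
    rw [Nat.mul_assoc] at hZ hY
    exact h m hm Z hZ X hX Y hY
  exact geometricHardCrossingLowerBound_of_setToSetQuasiMultAspectAt hl (Nat.le_mul_of_pos_left l (by omega)) (by positivity) hA2

/-- **Conditional annulus-uniqueness at aspect `l` at `p_c(ℤ³)` ⇒ 3-D RSW's lower half** (`l ≥ 2`, `c > 0`): if, given the two links, the closed annulus
`Λ(la) ∖ Λ(a)°` has all its sphere-to-sphere crossings joined with conditional probability `≥ c` (the numerically live hypothesis CU_l, census Q15: flat and
large at aspects `≥ 16`), then `GeometricHardCrossingLowerBound` (p1's `setToSetQM'_fixedAspect_of_condAnnulusUniq` + the previous corollary).  Companion of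
`kestenIICExists_of_condAnnulusUniq_aspect`: CU_l carries BOTH Kesten's IIC and the hard-direction box-crossing property.
[cite: BasuSapozhnikov2017ECP, §1 (comments on (A2), p. 4)] -/
theorem geometricHardCrossingLowerBound_of_condAnnulusUniq_aspect {l : ℕ} (hl : 2 ≤ l) {c : ℝ} (hc : 0 < c)
    (hCU : ∀ a : ℕ, 1 ≤ a → ∀ Z : Finset (Site 3), box 3 (l * a) \ box 3 (a - 1) ⊆ Z →
      ∀ X : Finset (Site 3), X ⊆ Z ∩ box 3 a → ∀ Y : Finset (Site 3), Y ⊆ Z \ box 3 (l * a) →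
        c * (bondPercolation (zdGraph 3) (criticalProbI 3)).real
            ({ω | ∃ x ∈ X, ∃ s ∈ innerBoundary (zdGraph 3) (box 3 (l * a)), ω ∈ openConnIn (↑Z : Set (Site 3)) x s} ∩
             {ω | ∃ y ∈ Y, ∃ s ∈ innerBoundary (zdGraph 3) (box 3 a), ω ∈ openConnIn (↑Z : Set (Site 3)) y s}) ≤
          (bondPercolation (zdGraph 3) (criticalProbI 3)).real
            ({ω | ∃ x ∈ X, ∃ s ∈ innerBoundary (zdGraph 3) (box 3 (l * a)), ω ∈ openConnIn (↑Z : Set (Site 3)) x s} ∩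
             {ω | ∃ y ∈ Y, ∃ s ∈ innerBoundary (zdGraph 3) (box 3 a), ω ∈ openConnIn (↑Z : Set (Site 3)) y s} ∩
             {ω | ∀ t ∈ innerBoundary (zdGraph 3) (box 3 a), ∀ s ∈ innerBoundary (zdGraph 3) (box 3 (l * a)),
                ∀ t' ∈ innerBoundary (zdGraph 3) (box 3 a), ∀ s' ∈ innerBoundary (zdGraph 3) (box 3 (l * a)),
                ω ∈ openConnIn (↑((box 3 (l * a) \ box 3 a) ∪ innerBoundary (zdGraph 3) (box 3 a)) : Set (Site 3)) t s →
                ω ∈ openConnIn (↑((box 3 (l * a) \ box 3 a) ∪ innerBoundary (zdGraph 3) (box 3 a)) : Set (Site 3)) t' s' →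
                ω ∈ openConnIn (↑((box 3 (l * a) \ box 3 a) ∪ innerBoundary (zdGraph 3) (box 3 a)) : Set (Site 3)) s s'})) :
    GeometricHardCrossingLowerBound :=
  geometricHardCrossingLowerBound_of_setToSetQM'_aspect hl hc
    (setToSetQM'_fixedAspect_of_condAnnulusUniq (criticalProbI 3) hl hc.le hCU)

/-- **The PRINTED (A2) at `p_c(ℤ³)` ⇒ 3-D RSW's lower half.**  Basu–Sapozhnikov's assumption (A2) verbatim — graph-metric balls `B(0,m) ⊂ S(0,2m) ⊂ B(0,4m)`,
connected `Z`, the Literature library's `BasuSapozhnikovQM (zdGraph 3) 0 p_c ϰ` — implies `GeometricHardCrossingLowerBound`: the lead's one-way rendering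
`setToSetQuasiMultAspectAt_of_basuSapozhnikovQM` (box form at aspect `(4d, 16d²) = (12, 144)`) followed by this generation's theorem at aspect `(12, 144)`.
[cite: BasuSapozhnikov2017ECP, §1 assumption (A2) and Thm. 1.1] -/
theorem geometricHardCrossingLowerBound_of_basuSapozhnikovQM {ϰ : ℝ} (hϰ : 0 < ϰ)
    (hBS : BasuSapozhnikovQM (zdGraph 3) (0 : Site 3) (criticalProbI 3) ϰ) : GeometricHardCrossingLowerBound := by
  have hbox := setToSetQuasiMultAspectAt_of_basuSapozhnikovQM (d := 3) (by norm_num) hϰ.le hBS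
  exact geometricHardCrossingLowerBound_of_setToSetQuasiMultAspectAt (s := 4 * 3) (L := 4 * 3 * (4 * 3)) (by norm_num) (by norm_num)
    (by positivity) hbox

end Rsw3

end Summit.CriticalPhenomena.PercolationContinuityZ3.Theorems
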